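import Literature.NumberTheory.Transcendental.PadicExpPolynomialBounds
import Literature.NumberTheory.Transcendental.LinGroupKRoyGlue
import Literature.NumberTheory.Transcendental.SixExponentialsPadicProofs
import HarnessLib

/-!
# Values of words of invariant derivations at the points `γ(h)`: the `p`-adic dictionary, and transport along field embeddings

Topic `Literature/NumberTheory/Transcendental` (namespace `Literature.NumberTheory.Transcendental`,
grouping sub-namespace `LinGroupK`). Everything here is PROVED; definitions with bodies (transport
of points / tangent vectors / frames along a ring homomorphism); no named facts.

Two pieces of plumbing for the `p`-adic auxiliary function ([Waldschmidt1988, §6]; [Roy1992, §1],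
"`K = ℂ_p`"):

* **Transport along an embedding of fields** `φ : K →+* K'` (not only isomorphisms, as in
  `LinGroupKTransport.lean`): points `ptMapHom φ`, tangent vectors `tmapHom φ`, `evalAt_mapHom`,
  `mapHom_invDeriv`, `mapHom_wordDeriv`, `ptMapHom_gammaOf`, frames `Frame.mapHom` with
  `map_genPoly`, `map_taylorCoeff` — the word values computed inside a number field `k₀ ⊂ K` (for
  the heights) or a `ℚ_p`-finite subfield `M ⊂ K` (for the box principle) are the same as in `K`.
* **The analytic dictionary** (`coe_evalAt_gammaOf_eq_expPolyVal`): inside a complete extension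
  `ι : K → E` (e.g. `ℚ̄_p ⊂ ℂ_p`), if `yᵢ = φ(ỹᵢ)` are frame images of vectors of norm `≤ 1`
  (frame of size `ρ < p⁻¹`) and `ι(αᵢⱼ) = exp(ι(yᵢⱼ))`, then for every `R ∈ K[X, Y]` and
  `h ∈ ℕ^m` the value of `R` at the point `γ(h) = (∑ hᵢyᵢ⁰, ∏ αᵢⱼ^{hᵢ})` (`LinGroupK.gammaOf`)
  is the value of the exponential polynomial `Φ_R` (`Frame.expPolyVal`) at `u_h = ∑ hᵢ ỹᵢ`:
  `ι(R(γ(h))) = Φ_R(u_h)` — the identity "`(D P)(exp_G y_h) = F_{DP}(u_h)`" by which the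
  smallness of the exponential polynomial (`Frame.norm_expPolyVal_le`) becomes the smallness of
  the algebraic numbers `(D P)(γ(h))` ([Waldschmidt1988, §6, p. 389]).

## References

* [Waldschmidt1988] M. Waldschmidt, *On the transcendence methods of Gel'fond and Schneider in
  several variables*, New Advances in Transcendence Theory (A. Baker ed.), CUP 1988, 375–398, §6
  (Proposition 6.1, p. 389).
* [Roy1992] D. Roy, *Matrices whose coefficients are linear forms in logarithms*, J. Number Theory
  41 (1992) 22–47, Notations (p. 24), §1 Theorem 1 (p. 25).
-/

noncomputable section

open MvPolynomial Finset
open Literature.RingTheory.MvPolynomial (linForm linForm_apply)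

namespace Literature.NumberTheory.Transcendental

namespace LinGroupK

section Hom

variable {K K' : Type*} [Field K] [Field K'] (φ : K →+* K') {d₀ d₁ n m : ℕ}

/-! ### Transport along a ring homomorphism -/

/-- `φ` applied coordinatewise to tangent vectors. [folklore] -/
def tmapHom (w : (Fin d₀ → K) × (Fin d₁ → K)) : (Fin d₀ → K') × (Fin d₁ → K') :=
  (fun i => φ (w.1 i), fun j => φ (w.2 j))

/-- Components of `tmapHom`. [folklore] -/
@[simp] theorem tmapHom_fst (w : (Fin d₀ → K) × (Fin d₁ → K)) (i : Fin d₀) : (tmapHom φ w).1 i = φ (w.1 i) := rfl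

/-- Components of `tmapHom`. [folklore] -/
@[simp] theorem tmapHom_snd (w : (Fin d₀ → K) × (Fin d₁ → K)) (j : Fin d₁) : (tmapHom φ w).2 j = φ (w.2 j) := rfl

/-- `φ` applied coordinatewise to points: a group homomorphism `G(K) → G(K')`. [folklore] -/
def ptMapHom : LinGroupK K d₀ d₁ →* LinGroupK K' d₀ d₁ where
  toFun g := (Multiplicative.ofAdd fun i => φ (Multiplicative.toAdd g.1 i),
    fun j => Units.map (φ : K →* K') (g.2 j))
  map_one' := by
    refine Prod.ext ?_ ?_
    · apply Multiplicative.toAdd.injective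
      funext i
      simp
    · funext j
      simp
  map_mul' g g' := by
    refine Prod.ext ?_ ?_
    · apply Multiplicative.toAdd.injective
      funext i
      simp
    · funext j
      simp

/-- Additive coordinates of `ptMapHom φ g`. [folklore] -/
@[simp] theorem toAdd_ptMapHom_fst (g : LinGroupK K d₀ d₁) (i : Fin d₀) :
    Multiplicative.toAdd (ptMapHom φ g).1 i = φ (Multiplicative.toAdd g.1 i) := rfl

/-- Multiplicative coordinates of `ptMapHom φ g`. [folklore] -/
@[simp] theorem coe_ptMapHom_snd (g : LinGroupK K d₀ d₁) (j : Fin d₁) :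
    ((ptMapHom φ g).2 j : K') = φ (g.2 j : K) := rfl

/-- `coord (ptMapHom φ g) = φ ∘ coord g`. [folklore] -/
theorem coord_ptMapHom (g : LinGroupK K d₀ d₁) : coord (ptMapHom φ g) = φ ∘ coord g := by
  funext v
  rcases v with i | j <;> rfl

/-- **Evaluation commutes with transport**: `(φP)(φg) = φ(P(g))`. [folklore] -/
theorem evalAt_mapHom (P : MvPolynomial (Fin d₀ ⊕ Fin d₁) K) (g : LinGroupK K d₀ d₁) :
    evalAt (map φ P) (ptMapHom φ g) = φ (evalAt P g) := by
  rw [evalAt_eq_eval, evalAt_eq_eval, coord_ptMapHom, eval_map]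
  have h := eval₂_comp_left φ (RingHom.id K) (coord g) P
  rw [RingHom.comp_id] at h
  exact h.symm

/-- **Transport of invariant derivations**: `φ(D_w P) = D_{φw}(φP)`. [folklore] -/
theorem mapHom_invDeriv (w : (Fin d₀ → K) × (Fin d₁ → K)) (P : MvPolynomial (Fin d₀ ⊕ Fin d₁) K) :
    map φ (invDeriv w P) = invDeriv (tmapHom φ w) (map φ P) := by
  induction P using MvPolynomial.induction_on with
  | C a => simp
  | add p q hp hq => rw [map_add, map_add, map_add, map_add, hp, hq]
  | mul_X p v hp =>
    have key : map φ (invDeriv w (X v)) =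
        invDeriv (tmapHom φ w) (X v : MvPolynomial (Fin d₀ ⊕ Fin d₁) K') := by
      rcases v with i | j
      · rw [invDeriv_X_inl, invDeriv_X_inl, map_C]
        rfl
      · rw [invDeriv_X_inr, invDeriv_X_inr, map_mul, map_C, map_X]
        rfl
    rw [Derivation.leibniz, smul_eq_mul, smul_eq_mul, map_add, map_mul, map_mul, hp, key, map_X,
      map_mul, map_X, Derivation.leibniz, smul_eq_mul, smul_eq_mul]

/-- **Transport of words**: `φ(D_u P) = D_{φu}(φP)`. [folklore] -/
theorem mapHom_wordDeriv {k : ℕ} (u : Fin k → (Fin d₀ → K) × (Fin d₁ → K))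
    (P : MvPolynomial (Fin d₀ ⊕ Fin d₁) K) :
    map φ (wordDeriv u P) = wordDeriv (fun i => tmapHom φ (u i)) (map φ P) := by
  induction k generalizing P with
  | zero => rfl
  | succ k ih =>
    rw [wordDeriv_succ, wordDeriv_succ, ih, mapHom_invDeriv]
    rfl

/-- **Transport of the points `γ(h)`**: `φ(γ_{y,α}(k)) = γ_{φy,φα}(k)`. [folklore] -/
theorem ptMapHom_gammaOf (y : Fin m → (Fin d₀ → K) × (Fin d₁ → K)) (α : Fin m → Fin d₁ → Kˣ)
    (k : Fin m → ℤ) :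
    ptMapHom φ (gammaOf y α (Multiplicative.ofAdd k)) =
      gammaOf (fun i => tmapHom φ (y i)) (fun i j => Units.map (φ : K →* K') (α i j))
        (Multiplicative.ofAdd k) := by
  refine Prod.ext ?_ ?_
  · apply Multiplicative.toAdd.injective
    funext i
    rw [toAdd_ptMapHom_fst, toAdd_gammaOf_fst, toAdd_gammaOf_fst]
    simp [map_sum, Finset.sum_apply]
  · funext j
    ext
    rw [coe_ptMapHom_snd, gammaOf_snd, gammaOf_snd]
    simp [map_prod]

/-! ### Transport of frames -/

namespace Frame

/-- `φ` applied to the coefficients of a frame. [folklore] -/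
def mapHom (Φ : Frame K n d₀ d₁) : Frame K' n d₀ d₁ := ⟨fun i k => φ (Φ.A i k), fun j k => φ (Φ.B j k)⟩

/-- Coefficients of the transported frame. [folklore] -/
@[simp] theorem mapHom_A (Φ : Frame K n d₀ d₁) (i : Fin d₀) (k : Fin n) : (Φ.mapHom φ).A i k = φ (Φ.A i k) := rfl

/-- Coefficients of the transported frame. [folklore] -/
@[simp] theorem mapHom_B (Φ : Frame K n d₀ d₁) (j : Fin d₁) (k : Fin n) : (Φ.mapHom φ).B j k = φ (Φ.B j k) := rfl

omit [Field K] [Field K'] in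
/-- Transport of linear forms. [folklore] -/
theorem map_linForm {K K' : Type*} [Field K] [Field K'] (φ : K →+* K') (c : Fin n → K) :
    map φ (linForm c : MvPolynomial (Fin n) K) = linForm (φ ∘ c) := by
  simp [linForm_apply, map_sum, smul_eq_C_mul]

/-- Transport of `A^{s₀}`. [folklore] -/
theorem map_monoX (Φ : Frame K n d₀ d₁) (s : Fin d₀ ⊕ Fin d₁ →₀ ℕ) :
    map φ (Φ.monoX s) = (Φ.mapHom φ).monoX s := by
  rw [monoX, monoX, map_prod]
  refine Finset.prod_congr rfl fun i _ => ?_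
  rw [map_pow, map_linForm]
  rfl

/-- Transport of `ℓ_s`. [folklore] -/
theorem map_formL (Φ : Frame K n d₀ d₁) (s : Fin d₀ ⊕ Fin d₁ →₀ ℕ) :
    map φ (Φ.formL s) = (Φ.mapHom φ).formL s := by
  rw [formL, formL, map_sum]
  refine Finset.sum_congr rfl fun j _ => ?_
  rw [map_mul, map_C, map_natCast, map_linForm]
  rfl

omit [Field K] [Field K'] in
/-- Transport of truncated exponentials. [folklore] -/
theorem map_truncExp {K K' : Type*} [Field K] [Field K'] (φ : K →+* K') (M : ℕ) (ℓ : MvPolynomial (Fin n) K) :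
    map φ (truncExp M ℓ) = truncExp M (map φ ℓ) := by
  rw [truncExp, truncExp, map_sum]
  refine Finset.sum_congr rfl fun ν _ => ?_
  rw [map_mul, map_C, map_pow, map_inv₀, map_natCast]

/-- **Transport of the generating polynomial.** [folklore] -/
theorem map_genPoly (Φ : Frame K n d₀ d₁) (M : ℕ) (R : MvPolynomial (Fin d₀ ⊕ Fin d₁) K) :
    map φ (Φ.genPoly M R) = (Φ.mapHom φ).genPoly M (map φ R) := by
  induction R using MvPolynomial.induction_on' with
  | add p q hp hq => simp only [map_add, hp, hq]
  | monomial s a =>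
    rw [genPoly_monomial, map_monomial, genPoly_monomial, smul_eq_C_mul, smul_eq_C_mul, map_mul, map_C,
      map_mul, map_monoX, map_truncExp, map_formL]

/-- **Transport of Taylor coefficients**: `φ(tc_κ(R)) = tc_κ(φR)` for the transported frame.
[folklore] -/
theorem map_taylorCoeff (Φ : Frame K n d₀ d₁) (κ : Fin n →₀ ℕ) (R : MvPolynomial (Fin d₀ ⊕ Fin d₁) K) :
    φ (Φ.taylorCoeff κ R) = (Φ.mapHom φ).taylorCoeff κ (map φ R) := by
  rw [taylorCoeff_apply, taylorCoeff_apply, ← map_genPoly, coeff_map]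

/-- Transport of `φ(wt)`: `φ(Φ.vec c) = (Φ.mapHom φ).vec (φ ∘ c)`. [folklore] -/
theorem tmapHom_vec (Φ : Frame K n d₀ d₁) (c : Fin n → K) :
    tmapHom φ (Φ.vec c) = (Φ.mapHom φ).vec (φ ∘ c) := by
  ext <;> simp [tmapHom, vec, map_sum]

end Frame

end Hom

/-! ### The analytic dictionary: word values as values of exponential polynomials -/

section Dictionary

variable {p : ℕ} [Fact p.Prime]
variable {K : Type*} [NontriviallyNormedField K] [NormedAlgebra ℚ_[p] K] [IsUltrametricDist K]
variable {E : Type} [NontriviallyNormedField E] [NormedAlgebra ℚ_[p] E] [IsUltrametricDist E]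
  [CompleteSpace E] (ι : K →+* E)
variable {n d₀ d₁ m : ℕ}

namespace Frame

variable {Φ : Frame K n d₀ d₁}

omit [NormedAlgebra ℚ_[p] K] [IsUltrametricDist K] in
/-- `φ` of an integer combination: `Φ.vec (∑ hᵢ ỹᵢ) = ∑ hᵢ Φ.vec ỹᵢ` (coordinates). [folklore] -/
theorem vec_natSum (yt : Fin m → Fin n → K) (h : Fin m → ℕ) :
    Φ.vec (fun k => ∑ i, (h i : K) * yt i k) =
      (fun i₀ => ∑ i, ((h i : ℤ) : K) • (Φ.vec (yt i)).1 i₀,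
        fun j => ∑ i, ((h i : ℤ) : K) • (Φ.vec (yt i)).2 j) := by
  ext i₀
  · simp only [vec, Finset.sum_mul, smul_eq_mul, Int.cast_natCast, Finset.mul_sum]
    rw [Finset.sum_comm]
    refine Finset.sum_congr rfl fun i _ => Finset.sum_congr rfl fun k _ => by ring
  · simp only [vec, Finset.sum_mul, smul_eq_mul, Int.cast_natCast, Finset.mul_sum]
    rw [Finset.sum_comm]
    refine Finset.sum_congr rfl fun i _ => Finset.sum_congr rfl fun k _ => by ring

include p in
/-- The points `u_h = ∑ hᵢ ỹᵢ` lie in the unit ball if the `ỹᵢ` do. [folklore] -/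
theorem norm_natSum_le {yt : Fin m → Fin n → K} (hyt : ∀ i k, ‖yt i k‖ ≤ 1) (h : Fin m → ℕ) (k : Fin n) :
    ‖∑ i, (h i : K) * yt i k‖ ≤ 1 := by
  refine IsUltrametricDist.norm_sum_le_of_forall_le_of_nonneg zero_le_one fun i _ => ?_
  rw [norm_mul]
  calc ‖(h i : K)‖ * ‖yt i k‖ ≤ 1 * 1 := by
        gcongr
        · exact PadicExp.norm_natCast_le_one (ℓ := p) (h i)
        · exact hyt i k
    _ = 1 := one_mul 1

/-- **The analytic dictionary.** Let `Φ` be a frame of size `ρ < p⁻¹`, `ỹᵢ ∈ K^n` of norm `≤ 1`,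
`yᵢ = Φ.vec ỹᵢ`, and `αᵢⱼ ∈ Kˣ` with `ι(αᵢⱼ) = exp(ι(yᵢⱼ))` in the complete extension `E`
(`ι` isometric). Then for every `R ∈ K[X, Y]` and `h ∈ ℕ^m`,
`ι(R(γ_{y,α}(h))) = Φ_R(u_h)`, `u_h = ∑ hᵢỹᵢ` (`Frame.expPolyVal`): the value of `R` at the point
`γ(h) = (∑ hᵢyᵢ⁰, ∏ αᵢⱼ^{hᵢ})` is the value at `u_h` of the exponential polynomial of `R` along
the frame (`∏ⱼ (∏ᵢ αᵢⱼ^{hᵢ})^{s₁ⱼ} = exp(ℓ_s(u_h))` by the functional equation on the ball).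
[cite: Waldschmidt1988, §6 Proposition 6.1 (p. 389)] -/
theorem coe_evalAt_gammaOf_eq_expPolyVal (hι : ∀ x, ‖ι x‖ = ‖x‖) {ρ : ℝ} (hρ : 0 ≤ ρ)
    (hρp : ρ < (p : ℝ)⁻¹) (hΦ : Φ.Small ρ)
    {yt : Fin m → Fin n → K} (hyt : ∀ i k, ‖yt i k‖ ≤ 1) {α : Fin m → Fin d₁ → Kˣ}
    (hα : ∀ i j, ι (α i j : K) = NormedSpace.exp (ι ((Φ.vec (yt i)).2 j)))
    (R : MvPolynomial (Fin d₀ ⊕ Fin d₁) K) (h : Fin m → ℕ) :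
    ι (evalAt R (gammaOf (fun i => Φ.vec (yt i)) α (Multiplicative.ofAdd fun i => (h i : ℤ)))) =
      Φ.expPolyVal ι R (fun k => ∑ i, (h i : K) * yt i k) := by
  classical
  set u : Fin n → K := fun k => ∑ i, (h i : K) * yt i k with hu
  set g := gammaOf (fun i => Φ.vec (yt i)) α (Multiplicative.ofAdd fun i => (h i : ℤ)) with hg
  have hun : ∀ k, ‖u k‖ ≤ 1 := norm_natSum_le (p := p) hyt h
  -- smallness of the exponents
  have hyj : ∀ i j, ‖ι ((Φ.vec (yt i)).2 j)‖ < (p : ℝ)⁻¹ := fun i j => by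
    rw [hι]
    exact lt_of_le_of_lt ((norm_vec_le hρ hΦ (hyt i)).2 j) hρp
  have hBu : ∀ j, ‖ι (eval u (linForm (Φ.B j)))‖ < (p : ℝ)⁻¹ := fun j => by
    rw [hι]
    exact lt_of_le_of_lt (norm_eval_le_of_coeff _ hun hρ fun κ _ => norm_coeff_linForm_le hρ (hΦ.2 j) κ) hρp
  -- additive coordinates: `γ(h)₀ᵢ = Aᵢ(u_h)`
  have hX : ∀ i₀, coord g (Sum.inl i₀) = eval u (linForm (Φ.A i₀)) := by
    intro i₀
    rw [coord_inl, hg, toAdd_gammaOf_fst, Finset.sum_apply, eval_linForm]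
    simp only [Pi.smul_apply, smul_eq_mul, vec, Int.cast_natCast, Finset.mul_sum, u]
    rw [Finset.sum_comm]
    exact Finset.sum_congr rfl fun k _ => Finset.sum_congr rfl fun i _ => by ring
  -- multiplicative coordinates: `ι(γ(h)₁ⱼ) = exp(ι(Bⱼ(u_h)))`
  have hY : ∀ j, ι (coord g (Sum.inr j)) = NormedSpace.exp (ι (eval u (linForm (Φ.B j)))) := by
    intro j
    rw [coord_inr, hg, gammaOf_snd, Units.coe_prod, map_prod]
    have e1 : ∀ i, ι (((α i j ^ ((fun i => (h i : ℤ)) i) : Kˣ) : K)) =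
        NormedSpace.exp (ι ((Φ.vec (yt i)).2 j)) ^ h i := fun i => by
      simp only [zpow_natCast, Units.val_pow_eq_pow_val, map_pow, hα]
    simp_rw [e1]
    rw [← SixExpPadic.exp_sum_natCast_mul (ℓ := p) Finset.univ _ h (fun i _ => hyj i j)]
    congr 1
    rw [eval_linForm, map_sum]
    simp only [vec, map_sum, map_mul, map_natCast, u, Finset.mul_sum]
    rw [Finset.sum_comm]
    exact Finset.sum_congr rfl fun k _ => Finset.sum_congr rfl fun i _ => by ring
  -- assemble
  rw [evalAt_eq_eval, eval_eq', map_sum, expPolyVal]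
  refine Finset.sum_congr rfl fun s _ => ?_
  have hPX : ∏ i₀, coord g (Sum.inl i₀) ^ s (Sum.inl i₀) = eval u (Φ.monoX s) := by
    rw [monoX, map_prod]
    exact Finset.prod_congr rfl fun i₀ _ => by rw [map_pow, hX]
  have hPY : ι (∏ j, coord g (Sum.inr j) ^ s (Sum.inr j)) = NormedSpace.exp (ι (eval u (Φ.formL s))) := by
    rw [map_prod]
    simp_rw [map_pow, hY]
    rw [← SixExpPadic.exp_sum_natCast_mul (ℓ := p) Finset.univ _ (fun j => s (Sum.inr j)) (fun j _ => hBu j)]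
    congr 1
    rw [formL, map_sum, map_sum]
    refine Finset.sum_congr rfl fun j _ => ?_
    rw [map_mul, eval_C, map_mul, map_natCast]
  rw [Fintype.prod_sum_type, hPX, ← mul_assoc, map_mul, hPY]

end Frame

end Dictionary

end LinGroupK

end Literature.NumberTheory.Transcendental
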